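import Literature.AnabelianGeometry.EtaleTheta.ThetaKummerInputDeckOfCore
import Literature.AnabelianGeometry.EtaleTheta.KummerContH1Kernel
import Literature.AnabelianGeometry.EtaleTheta.ThetaClassModL
import Literature.AnabelianGeometry.EtaleTheta.Discharge.Sec1ConstCompatSchema
import Literature.AnabelianGeometry.EtaleTheta.Discharge.Sec2Cor218Cor219AtModelChi
import HarnessLib

/-!
# The DECK identity of [EtTh] Prop 1.4 (ii) FORCES a non-trivial Kummer class of `Θ̈` (genuine constants), and the
# `Ü`-monomial witness at the χ-model has `κ(Θ̈) ≠ 1` (proof-only)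

S. Mochizuki, *The étale theta function …*, Publ. RIMS **45** (2009) [EtTh], Prop 1.4 (ii) p. 22 («`Θ̈(−Ü) = −Θ̈(Ü)`»),
Prop 1.3 p. 21 (Kummer classes of constants), Def 2.7 p. 41 (`[Π^tp_Y : Π^tp_Ÿ] = 2`). Classical here.

abc-iut cell, layer L2, seat abc-iut-w5-d125 (gen 7); PROOF-ONLY (0 defs; D-0067). Sequel of
`ThetaKummerInputDeckOfCore.lean` (p454127): there the `Ü`-monomial module witnesses, at `modelχ`, a `ThetaKummerInput`
with GENUINE coefficients, `ConstCompat` and the deck identity `hdeck`. THIS FILE shows such a witness is automatically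
GENUINE AT THE CLASS LEVEL too:

* `ThetaKummerInput.kummerTheta_ne_one_of_deck` — for ANY theta-Kummer input with BIJECTIVE coefficients `Λ(Fn) ≅ Δ_Θ`,
  `Π^tp_Ÿ ⊴ Π^tp_X` and an element `ε` with `ε • Θ̈ = const(−1)·Θ̈` (a deck element, by `hdeck`): `ConstCompat k ⇒ κ(Θ̈) ≠ 1`.
  Proof: `κ(Θ̈) = 1` gives (this seat's `kummerContClass_eq_one_iff`, p414345) a `Π^tp_Ÿ`-INVARIANT compatible root
  system `x'` of `Θ̈`; then `d_N := ε•x'_N · x'_N⁻¹` is a `Π^tp_Ÿ`-invariant root system of `ε•Θ̈·Θ̈⁻¹ = const(−1)`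
  (normality: `ε⁻¹hε ∈ Π^tp_Ÿ`), so `κ(−1) = 1` — contradicting abc-iut-f-117's `kummerConst_neg_one_ne_one_of_constCompat`.
* `SettingModel.exists_thetaKummerInput_deck_genuine_modelχ` — hence at `modelχ` the witness of p454127 has
  `κ(Θ̈) ≠ 1` as well: **bijective coefficients ∧ ConstCompat (kummerDataχ) ∧ hdeck ∧ κ(Θ̈) ≠ 1 ∧ (no inversion package
  for the inversion of record)** — jointly, in the kernel.

HONEST FRAMING: semi-synthetic model at `modelχ` (consistency evidence only); nothing of [EtTh] asserted; no side taken on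
[IUTchIII] Cor 3.12.
-/

noncomputable section

namespace Literature.AnabelianGeometry.EtaleTheta

open Literature.AnabelianGeometry.SemiGraphs

namespace ThetaSetting

namespace ThetaKummerInput

variable {p : ℕ} [Fact p.Prime] {D : ThetaSetting p} (T : D.ThetaKummerInput)

/-- **The deck identity forces `κ(Θ̈) ≠ 1` (genuine constants).** If `T` has bijective coefficients, `Π^tp_Ÿ ⊴ Π^tp_X`,
SOME `ε ∈ Π^tp_X` satisfies `ε • Θ̈ = const(−1)·Θ̈` (e.g. a deck element, by `hdeck`), and `T` is `ConstCompat` with some Kummer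
datum `k`, then the Kummer class of `Θ̈` in `H¹(Π^tp_Ÿ, Δ_Θ)` is non-trivial. [cite: MochizukiEtTh2009, Prop 1.4 (ii) p.22] -/
theorem kummerTheta_ne_one_of_deck [hN : D.GtpYdd.Normal] (hbij : Function.Bijective T.coeff.hom)
    {ε : D.PiTemp} (hε : ε • T.theta = T.const (-1) * T.theta)
    {k : D.KummerData} (hcc : T.ConstCompat k) : T.kummerTheta ≠ 1 := by
  intro h1
  -- a `Π^tp_Ÿ`-invariant compatible root system of `Θ̈`
  obtain ⟨x', hx'⟩ := (T.coeff.kummerContClass_eq_one_iff D.GtpYdd hbij T.isOpen_stabilizer T.thetaRoots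
    T.theta_mem).mp h1
  -- the root system `d_N := ε•x'_N · x'_N⁻¹` of `const(−1)`
  have hd : ε • T.theta * T.theta⁻¹ = T.const (-1) := by rw [hε, mul_inv_cancel_right]
  let d : RootSystem (T.const (-1)) := ((x'.smul ε).mul x'.inv).cast hd
  have hdroot : ∀ n, d.root n = ε • x'.root n * (x'.root n)⁻¹ := fun _ => rfl
  -- it is `Π^tp_Ÿ`-invariant (normality of `Π^tp_Ÿ`)
  have hdinv : d.IsInvariant D.GtpYdd := by
    intro n h
    rw [hdroot, smul_mul', smul_inv', hx' n h, ← mul_smul]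
    have hconj : ε⁻¹ * ((h : D.PiTemp) * ε) ∈ D.GtpYdd := by
      have := hN.conj_mem _ h.2 ε⁻¹
      rwa [inv_inv, mul_assoc] at this
    have h2 : ((h : D.PiTemp) * ε) • x'.root n = ε • x'.root n := by
      conv_lhs => rw [show (h : D.PiTemp) * ε = ε * (ε⁻¹ * ((h : D.PiTemp) * ε)) by group, mul_smul,
        hx' n ⟨_, hconj⟩]
    rw [h2]
  -- hence `κ(−1) = 1`, contradicting `ConstCompat`
  have hK : T.kummerConst (-1) = 1 := by
    rw [kummerConst, T.coeff.kummerContClass_eq D.GtpYdd (T.constRoots (-1)) d (T.const_mem (-1)) _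
      (fun _ => T.isOpen_stabilizer _)]
    exact T.coeff.kummerContClass_eq_one_of_isInvariant D.GtpYdd d hdinv (T.const_mem (-1)) _
  exact T.kummerConst_neg_one_ne_one_of_constCompat hcc hK

end ThetaKummerInput

end ThetaSetting

/-! ### At the χ-twisted root model: the `Ü`-monomial witness is genuine at the class level -/

namespace SettingModel

variable (p : ℕ) [Fact p.Prime]

/-- **At `modelχ`**: a theta-Kummer input with BIJECTIVE coefficients, `ConstCompat (kummerDataχ p)`, the DECK identity,
a NON-TRIVIAL Kummer class `κ(Θ̈) ≠ 1`, and NO function-level inversion package for the inversion of record — all at once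
(the witness of p454127; `κ(Θ̈) ≠ 1` by `kummerTheta_ne_one_of_deck` with a deck element from `Sec2Hyps` and
`Π^tp_Ÿ ⊴ Π^tp_X` from `Compat`). [cite: MochizukiEtTh2009, Prop 1.4 (ii) p.22] -/
theorem exists_thetaKummerInput_deck_genuine_modelχ :
    ∃ T : (ThetaSetting.modelχ p).ThetaKummerInput, letI := T.instAction
      Function.Bijective T.coeff.hom ∧ T.ConstCompat (kummerDataχ p) ∧
      (∀ ε : (ThetaSetting.modelχ p).PiTemp, ε ∈ (ThetaSetting.modelχ p).GtpY → ε ∉ (ThetaSetting.modelχ p).GtpYdd →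
        ε • T.theta = T.const (-1) * T.theta) ∧
      T.kummerTheta ≠ 1 ∧
      ¬ ∃ ιFn : T.Fn →* T.Fn,
        (∀ (g : (ThetaSetting.modelχ p).PiTemp) (f : T.Fn),
          ιFn (g • f) = (twistedInversionTop (chi p) (isInducing_leftRightχ p) :
            (ThetaSetting.modelχ p).PiTemp ≃ₜ* (ThetaSetting.modelχ p).PiTemp) g • ιFn f) ∧
        (∀ ζ : cyclotome T.Fn, cyclotome.map ιFn ζ = ζ) ∧ ιFn T.theta = T.const (-1) * T.theta := by
  obtain ⟨T, hb, hcc, hdeck, hno⟩ := exists_thetaKummerInput_deck_not_package_modelχ p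
  obtain ⟨ε, hε₁, hε₂⟩ := (ThetaSetting.modelχ p).exists_mem_GtpY_not_mem_GtpYdd (ThetaSetting.modelχ_sec2Hyps p)
  haveI := (compat_modelχ p).GtpYdd_normal
  exact ⟨T, hb, hcc, hdeck, T.kummerTheta_ne_one_of_deck hb (hdeck ε hε₁ hε₂) hcc, hno⟩

end SettingModel

end Literature.AnabelianGeometry.EtaleTheta
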